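import Mathlib.RingTheory.MvPolynomial.WeightedHomogeneous
import Mathlib.Algebra.MvPolynomial.Variables
import Mathlib.Algebra.MvPolynomial.CommRing
import Mathlib.Data.Nat.Log
import HarnessLib

/-!
# Sparse polynomials under a full-support shift: Oliveira's product-sparsity bound and the
# narrow-monomial lemma (Forbes–Shpilka–Volk 2018, Lemmas 32–33), over any integral domain

Forbes–Shpilka–Volk, *Succinct hitting sets and barriers to proving lower bounds for algebraic
circuits*, Theory Comput. 14 (2018) = arXiv:1701.05328, §5.1 (numbering of the arXiv text):

* **Lemma 33** (the case used; [Forbes–Saptharishi–Tse–Wigderson 2016, Prop. 6.14]): for a finite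
  set `S` of variables, scalars `a_i ≠ 0` (`i ∈ S`) and a NONZERO polynomial `H` (any variables, any
  integral domain), the product `(∏_{i ∈ S} (X_i - a_i)) · H` has at least `2^{|S|}` monomials —
  `prodSparsity` (the printed Lemma 33 speaks of an arbitrary multilinear factor and says "at most",
  an erratum for "at least"; the product-of-linear-forms case is what Lemma 32 uses).
* **Lemma 32** ([Forbes 2015], [Gurjar–Korwar–Saxena–Thierauf 2016]): if `D ≠ 0` has at most `s`
  monomials and `a` is a full-support vector (`a_i ≠ 0` for all `i`), the Taylor shift `D(a + X)`
  has a monomial involving at most `log₂ s` variables — `exists_narrow_monomial` (form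
  `2^{|supp m|} ≤ |supp D|`) and `exists_narrow_monomial_log` (form `|supp m| ≤ Nat.log 2 s`).

These are the two lemmas behind the sparse bullet of FSV Thm. 9 / Cor. 34 (the shifted succinct
Shpilka–Volkovich generator hits sparse polynomials); they are used in
`FSV18SparseHittingProofs.lean` to discharge the tree's named facts
`ForbesShpilkaVolk2018_svGeneratorHitsSparse` (`SuccinctSVGenerator.lean`) and `FSV2018_lemma32`
(`FSV18SuccinctGenerators.lean`). The proofs are the route-side arguments of
`Summits/ValiantsHypothesis/…/BarrierLeverSuccinctHittingSetsForVPStub{ProdSparsity,ShiftSmallSupport}.lean`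
(there over `ℂ`; `Literature/` cannot import `Summits/`), generalised verbatim to an arbitrary
integral domain `R`.

**Proof of Lemma 33 (special case).** Induction on `S`. One more factor `X_i - c` (`c ≠ 0`, `X_i`
not occurring in `R = ∏_{j ∈ S} (X_j - a_j)`) doubles any uniform lower bound on the sparsity of the
multiples `R · G`: the bottom `X_i`-slice of `R · H` survives in `(X_i - c) · R · H` multiplied by
`-c`, the top slice survives shifted by `X_i`, disjointly (`card_add_card_le_card_support`, `step`).
**Proof of Lemma 32.** Let `G = D(a + X) ≠ 0` and `m₀` a monomial of `G` with the fewest variables,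
`S = supp m₀`. Killing the variables outside `S` leaves a nonzero `P` all of whose monomials are
supported on exactly `S`, so `P = (∏_{i ∈ S} X_i) · H`, `H ≠ 0`; un-shifting turns `P` into
`(∏_{i ∈ S} (X_i - a_i)) · H(X - a)` — at least `2^{|S|}` monomials — and simultaneously into the
partial evaluation `D(X_S, a_{Sᶜ})` — at most `|supp D|` monomials.

## References
* [ForbesShpilkaVolk2018] M. A. Forbes, A. Shpilka, B. L. Volk, Theory Comput. 14 (2018),
  arXiv:1701.05328, Lemma 32 and Lemma 33 (§5.1).
-/

noncomputable section

namespace Literature.Computability.AlgebraicComplexity.SparseShift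

open MvPolynomial

variable {R : Type*} [CommRing R] {σ : Type*}

/-! ### Slices by the degree in one variable -/

/-- Coefficients of the `X_i`-degree-`j` slice of `H` (the weighted homogeneous component for the
weight `Pi.single i 1`). [cite: ForbesShpilkaVolk2018, Lemma 33 (proof)] -/
theorem coeff_slice [DecidableEq σ] (i : σ) (j : ℕ) (H : MvPolynomial σ R) (m : σ →₀ ℕ) :
    coeff m (weightedHomogeneousComponent (Pi.single i 1) j H) =
      if m i = j then coeff m H else 0 := by
  rw [coeff_weightedHomogeneousComponent, Finsupp.weight_single_one_apply]

/-- Support of the `X_i`-degree-`j` slice of `H`. [cite: ForbesShpilkaVolk2018, Lemma 33 (proof)] -/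
theorem mem_support_slice [DecidableEq σ] {i : σ} {j : ℕ} {H : MvPolynomial σ R} {m : σ →₀ ℕ} :
    m ∈ (weightedHomogeneousComponent (Pi.single i 1) j H).support ↔ m i = j ∧ m ∈ H.support := by
  rw [mem_support_iff, mem_support_iff, coeff_slice]
  split_ifs with h
  · exact (and_iff_right h).symm
  · simp [h]

/-- The slice of `H` through one of its monomials is nonzero.
[cite: ForbesShpilkaVolk2018, Lemma 33 (proof)] -/
theorem slice_ne_zero [DecidableEq σ] (i : σ) {H : MvPolynomial σ R} {m : σ →₀ ℕ}
    (hm : m ∈ H.support) : weightedHomogeneousComponent (Pi.single i 1) (m i) H ≠ 0 := by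
  intro h0
  have h := coeff_slice i (m i) H m
  rw [h0, coeff_zero, if_pos rfl] at h
  exact mem_support_iff.mp hm h.symm

/-- If `R` does not involve `X_i`, the `X_i`-degree of a monomial of `R * G` is the `X_i`-degree of
a monomial of `G`. [cite: ForbesShpilkaVolk2018, Lemma 33 (proof)] -/
theorem apply_of_mem_support_mul {i : σ} {P G : MvPolynomial σ R} (hP : ∀ u ∈ P.support, u i = 0)
    {p : ℕ → Prop} (hG : ∀ v ∈ G.support, p (v i)) {m : σ →₀ ℕ} (hm : m ∈ (P * G).support) :
    p (m i) := by
  classical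
  obtain ⟨u, hu, v, hv, rfl⟩ := Finset.mem_add.mp (support_mul P G hm)
  rw [Finsupp.add_apply, hP u hu, zero_add]
  exact hG v hv

/-- If `P` does not involve `X_i`, the coefficient of `m` in `P * H` only sees the slice of `H` of
`X_i`-degree `m i`. [cite: ForbesShpilkaVolk2018, Lemma 33 (proof)] -/
theorem coeff_mul_eq_coeff_mul_slice [DecidableEq σ] {i : σ} {P : MvPolynomial σ R}
    (hP : ∀ u ∈ P.support, u i = 0) (H : MvPolynomial σ R) (m : σ →₀ ℕ) :
    coeff m (P * H) = coeff m (P * weightedHomogeneousComponent (Pi.single i 1) (m i) H) := by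
  have hrest : coeff m (P * (H - weightedHomogeneousComponent (Pi.single i 1) (m i) H)) = 0 := by
    by_contra h
    have key : ∀ v ∈ (H - weightedHomogeneousComponent (Pi.single i 1) (m i) H).support,
        ¬ v i = m i := by
      intro v hv hvi
      rw [mem_support_iff, coeff_sub, coeff_slice, if_pos hvi, sub_self] at hv
      exact hv rfl
    exact absurd rfl (apply_of_mem_support_mul hP (p := fun k => ¬ k = m i) key
      (mem_support_iff.mpr h))
  calc coeff m (P * H)
      = coeff m (P * weightedHomogeneousComponent (Pi.single i 1) (m i) H +
          P * (H - weightedHomogeneousComponent (Pi.single i 1) (m i) H)) := by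
        rw [← mul_add, add_sub_cancel]
    _ = coeff m (P * weightedHomogeneousComponent (Pi.single i 1) (m i) H) := by
        rw [coeff_add, hrest, add_zero]

/-! ### FSV Lemma 33 (product-sparsity, the product-of-linear-forms case) -/

section Domain

variable [IsDomain R]

/-- **Univariate core.** If the `X_i`-degrees of the monomials of `Q` lie in `[j₀, j₁]`, and `Q₀`,
`Q₁` are polynomials living in `X_i`-degree `j₀`, `j₁` whose coefficients agree with those of `Q`
on their supports, then for `c ≠ 0` the product `(X_i - c) · Q` has at least
`|supp Q₀| + |supp Q₁|` monomials: `supp Q₀` survives (times `-c`) and `supp Q₁` survives shifted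
by `X_i`, disjointly. [cite: ForbesShpilkaVolk2018, Lemma 33] -/
theorem card_add_card_le_card_support (i : σ) {c : R} (hc : c ≠ 0) {Q Q₀ Q₁ : MvPolynomial σ R}
    {j₀ j₁ : ℕ} (hj : j₀ ≤ j₁) (hlow : ∀ m ∈ Q.support, j₀ ≤ m i)
    (hhigh : ∀ m ∈ Q.support, m i ≤ j₁) (hdeg₀ : ∀ m ∈ Q₀.support, m i = j₀)
    (hdeg₁ : ∀ m ∈ Q₁.support, m i = j₁) (hcoeff₀ : ∀ m ∈ Q₀.support, coeff m Q = coeff m Q₀)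
    (hcoeff₁ : ∀ m ∈ Q₁.support, coeff m Q = coeff m Q₁) :
    Q₀.support.card + Q₁.support.card ≤ ((X i - C c) * Q).support.card := by
  classical
  have hP : ∀ m : σ →₀ ℕ, coeff m ((X i - C c) * Q) =
      (if i ∈ m.support then coeff (m - Finsupp.single i 1) Q else 0) - c * coeff m Q :=
    fun m => by rw [sub_mul, coeff_sub, coeff_X_mul', coeff_C_mul]
  have hA : Q₀.support ⊆ ((X i - C c) * Q).support := by
    intro m hm
    have hmi := hdeg₀ m hm
    rw [mem_support_iff, hP]
    have h1 : (if i ∈ m.support then coeff (m - Finsupp.single i 1) Q else 0) = 0 := by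
      split_ifs with him
      · by_contra hne
        have h2 := hlow _ (mem_support_iff.mpr hne)
        rw [Finsupp.tsub_apply, Finsupp.single_eq_same, hmi] at h2
        rw [Finsupp.mem_support_iff, hmi] at him
        omega
      · rfl
    rw [h1, zero_sub, neg_ne_zero, hcoeff₀ m hm]
    exact mul_ne_zero hc (mem_support_iff.mp hm)
  have hB : Q₁.support.image (· + Finsupp.single i 1) ⊆ ((X i - C c) * Q).support := by
    intro m hm
    obtain ⟨m', hm', rfl⟩ := Finset.mem_image.mp hm
    have hmi := hdeg₁ m' hm'
    rw [mem_support_iff, hP]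
    have him : i ∈ (m' + Finsupp.single i 1).support := by
      rw [Finsupp.mem_support_iff, Finsupp.add_apply, Finsupp.single_eq_same]; omega
    have h2 : coeff (m' + Finsupp.single i 1) Q = 0 := by
      by_contra hne
      have h3 := hhigh _ (mem_support_iff.mpr hne)
      rw [Finsupp.add_apply, Finsupp.single_eq_same, hmi] at h3
      omega
    rw [if_pos him, add_tsub_cancel_right, h2, mul_zero, sub_zero, hcoeff₁ m' hm']
    exact mem_support_iff.mp hm'
  have hAB : Disjoint Q₀.support (Q₁.support.image (· + Finsupp.single i 1)) := by
    rw [Finset.disjoint_left]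
    intro m hmA hmB
    obtain ⟨m', hm', rfl⟩ := Finset.mem_image.mp hmB
    have h1 := hdeg₀ _ hmA
    rw [Finsupp.add_apply, Finsupp.single_eq_same, hdeg₁ m' hm'] at h1
    omega
  rw [← Finset.card_image_of_injective Q₁.support (add_left_injective (Finsupp.single i 1)),
    ← Finset.card_union_of_disjoint hAB]
  exact Finset.card_le_card (Finset.union_subset hA hB)

/-- **Inductive step.** If `P` does not involve `X_i` and every multiple `P · G` (`G ≠ 0`) has at
least `N` monomials, then for `c ≠ 0` and `H ≠ 0` the product `(X_i - c) · (P · H)` has at least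
`N + N` monomials (univariate core applied to the bottom and top `X_i`-slices of `H`).
[cite: ForbesShpilkaVolk2018, Lemma 33] -/
theorem step (i : σ) {c : R} (hc : c ≠ 0) {P : MvPolynomial σ R} (hP : ∀ u ∈ P.support, u i = 0)
    {N : ℕ} (hN : ∀ G : MvPolynomial σ R, G ≠ 0 → N ≤ (P * G).support.card)
    {H : MvPolynomial σ R} (hH : H ≠ 0) : N + N ≤ ((X i - C c) * (P * H)).support.card := by
  classical
  obtain ⟨m₀, hm₀, hmin⟩ : ∃ m₀ ∈ H.support, ∀ m ∈ H.support, m₀ i ≤ m i :=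
    H.support.exists_min_image (fun m => m i) (support_nonempty.mpr hH)
  obtain ⟨m₁, hm₁, hmax⟩ : ∃ m₁ ∈ H.support, ∀ m ∈ H.support, m i ≤ m₁ i :=
    H.support.exists_max_image (fun m => m i) (support_nonempty.mpr hH)
  have hdeg : ∀ j : ℕ, ∀ m ∈ (P * weightedHomogeneousComponent (Pi.single i 1) j H).support,
      m i = j :=
    fun j m hm => apply_of_mem_support_mul hP (p := fun k => k = j)
      (fun v hv => (mem_support_slice.mp hv).1) hm
  have hcoeff : ∀ j : ℕ, ∀ m ∈ (P * weightedHomogeneousComponent (Pi.single i 1) j H).support,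
      coeff m (P * H) = coeff m (P * weightedHomogeneousComponent (Pi.single i 1) j H) :=
    fun j m hm => by rw [coeff_mul_eq_coeff_mul_slice hP H m, hdeg j m hm]
  refine le_trans (add_le_add (hN _ (slice_ne_zero i hm₀)) (hN _ (slice_ne_zero i hm₁))) ?_
  exact card_add_card_le_card_support i hc (hmin m₁ hm₁)
    (fun m hm => apply_of_mem_support_mul hP (p := fun k => m₀ i ≤ k) hmin hm)
    (fun m hm => apply_of_mem_support_mul hP (p := fun k => k ≤ m₁ i) hmax hm)
    (hdeg _) (hdeg _) (hcoeff _) (hcoeff _)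

/-- The product `∏_{j ∈ S} (X_j - a_j)` does not involve `X_i` for `i ∉ S`.
[cite: ForbesShpilkaVolk2018, Lemma 33 (proof)] -/
theorem prod_support_apply (S : Finset σ) (a : σ → R) {i : σ} (hi : i ∉ S) :
    ∀ u ∈ (∏ j ∈ S, (X j - C (a j)) : MvPolynomial σ R).support, u i = 0 := by
  classical
  intro u hu
  by_contra h
  have hmem : i ∈ (∏ j ∈ S, (X j - C (a j)) : MvPolynomial σ R).vars :=
    (mem_vars_iff_mem_support i).mpr ⟨u, hu, Finsupp.mem_support_iff.mpr h⟩
  obtain ⟨j, hj, hij⟩ :=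
    Finset.mem_biUnion.mp (vars_prod (fun j => (X j - C (a j) : MvPolynomial σ R)) hmem)
  rcases Finset.mem_union.mp (vars_sub_subset _ hij) with h' | h'
  · rw [vars_X, Finset.mem_singleton] at h'
    subst h'
    exact hi hj
  · simp [vars_C] at h'

/-- **FSV Lemma 33, the case of a product of linear forms (Oliveira; FSTW16 Prop. 6.14):**
multiplying a nonzero polynomial `H` by `∏_{i ∈ S} (X_i - a_i)` with all `a_i ≠ 0` yields at least
`2^{|S|}` monomials (any integral domain, any set of variables). Induction on `S` via `step`.
[cite: ForbesShpilkaVolk2018, Lemma 33] -/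
theorem prodSparsity (S : Finset σ) (a : σ → R) (ha : ∀ i ∈ S, a i ≠ 0)
    (H : MvPolynomial σ R) (hH : H ≠ 0) :
    2 ^ S.card ≤ ((∏ i ∈ S, (X i - C (a i))) * H).support.card := by
  classical
  induction S using Finset.induction_on generalizing H with
  | empty =>
    rw [Finset.prod_empty, one_mul, Finset.card_empty, pow_zero]
    exact (support_nonempty.mpr hH).card_pos
  | insert i S hi ih =>
    rw [Finset.prod_insert hi, mul_assoc, Finset.card_insert_of_notMem hi, pow_succ, mul_two]
    exact step i (ha i (Finset.mem_insert_self i S)) (prod_support_apply S a hi)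
      (fun G hG => ih (fun k hk => ha k (Finset.mem_insert_of_mem hk)) G hG) hH

end Domain

/-! ### Substitutions: shift, un-shift, killing variables, partial evaluation -/

/-- Un-shifting the shift: substituting `X - a` into `D(a + X)` gives back `D`.
[cite: ForbesShpilkaVolk2018, Lemma 32 (proof)] -/
theorem unshift_shift (a : σ → R) (D : MvPolynomial σ R) :
    aeval (fun i => X i - C (a i)) (aeval (fun i => C (a i) + X i) D) = D := by
  have key : ((aeval fun i => X i - C (a i)) : MvPolynomial σ R →ₐ[R] MvPolynomial σ R).comp
      (aeval fun i => C (a i) + X i) = AlgHom.id R (MvPolynomial σ R) :=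
    MvPolynomial.algHom_ext fun i => by simp
  exact AlgHom.congr_fun key D

/-- Shifting the un-shift: substituting `a + X` into `D(X - a)` gives back `D`.
[cite: ForbesShpilkaVolk2018, Lemma 32 (proof)] -/
theorem shift_unshift (a : σ → R) (D : MvPolynomial σ R) :
    aeval (fun i => C (a i) + X i) (aeval (fun i => X i - C (a i)) D) = D := by
  have key : ((aeval fun i => C (a i) + X i) : MvPolynomial σ R →ₐ[R] MvPolynomial σ R).comp
      (aeval fun i => X i - C (a i)) = AlgHom.id R (MvPolynomial σ R) :=
    MvPolynomial.algHom_ext fun i => by simp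
  exact AlgHom.congr_fun key D

/-- A polynomial each of whose monomials involves every variable of `S` is divisible by
`∏_{i ∈ S} X_i`. [cite: ForbesShpilkaVolk2018, Lemma 32 (proof)] -/
theorem prod_X_dvd (S : Finset σ) (P : MvPolynomial σ R) (h : ∀ m ∈ P.support, S ⊆ m.support) :
    (∏ i ∈ S, (X i : MvPolynomial σ R)) ∣ P := by
  conv_rhs => rw [P.as_sum]
  refine Finset.dvd_sum fun m hm => ?_
  rw [monomial_eq, Finsupp.prod]
  refine dvd_mul_of_dvd_right ?_ _
  refine (Finset.prod_dvd_prod_of_dvd _ _ fun i hi => ?_).trans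
    (Finset.prod_dvd_prod_of_subset S m.support _ (h m hm))
  exact dvd_pow_self (X i) (Finsupp.mem_support_iff.mp (h m hm hi))

variable [DecidableEq σ]

/-- On a monomial supported inside `S`, killing the variables outside `S` is the identity.
[cite: ForbesShpilkaVolk2018, Lemma 32 (proof)] -/
theorem subst_monomial_of_subset (S : Finset σ) {m : σ →₀ ℕ} (hm : m.support ⊆ S) (c : R) :
    aeval (fun i => if i ∈ S then (X i : MvPolynomial σ R) else 0) (monomial m c) =
      monomial m c := by
  rw [aeval_monomial, Finsupp.prod]
  have : ∏ i ∈ m.support, (if i ∈ S then (X i : MvPolynomial σ R) else 0) ^ m i =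
      ∏ i ∈ m.support, X i ^ m i :=
    Finset.prod_congr rfl fun i hi => by rw [if_pos (hm hi)]
  rw [this, prod_X_pow_eq_monomial, MvPolynomial.algebraMap_eq, C_mul_monomial, mul_one]

/-- A monomial using a variable outside `S` is killed. [cite: ForbesShpilkaVolk2018, Lemma 32 (proof)] -/
theorem subst_monomial_of_not_subset (S : Finset σ) {m : σ →₀ ℕ} (hm : ¬ m.support ⊆ S)
    (c : R) : aeval (fun i => if i ∈ S then (X i : MvPolynomial σ R) else 0) (monomial m c) = 0 := by
  rw [aeval_monomial, Finsupp.prod]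
  obtain ⟨i, hi, hiS⟩ := Finset.not_subset.mp hm
  rw [Finset.prod_eq_zero hi, mul_zero]
  rw [if_neg hiS, zero_pow (Finsupp.mem_support_iff.mp hi)]

/-- The coefficient of a monomial supported inside `S` survives killing the variables outside `S`.
[cite: ForbesShpilkaVolk2018, Lemma 32 (proof)] -/
theorem coeff_subst_self (S : Finset σ) (D : MvPolynomial σ R) {m₀ : σ →₀ ℕ}
    (hm₀ : m₀.support ⊆ S) :
    coeff m₀ (aeval (fun i => if i ∈ S then (X i : MvPolynomial σ R) else 0) D) = coeff m₀ D := by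
  conv_lhs => rw [D.as_sum, map_sum]
  rw [coeff_sum, Finset.sum_eq_single m₀]
  · rw [subst_monomial_of_subset S hm₀, coeff_monomial, if_pos rfl]
  · intro m _ hne
    by_cases hm : m.support ⊆ S
    · rw [subst_monomial_of_subset S hm, coeff_monomial, if_neg hne]
    · rw [subst_monomial_of_not_subset S hm, coeff_zero]
  · intro hnot
    rw [notMem_support_iff.mp hnot, monomial_zero, map_zero, coeff_zero]

/-- Shift by `a`, kill the variables outside `S`, un-shift: the composite is the partial
evaluation `X i ↦ X i` (`i ∈ S`), `X i ↦ a i` (`i ∉ S`). [cite: ForbesShpilkaVolk2018, Lemma 32 (proof)] -/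
theorem unshift_subst_shift (S : Finset σ) (a : σ → R) (D : MvPolynomial σ R) :
    aeval (fun i => X i - C (a i))
        (aeval (fun i => if i ∈ S then (X i : MvPolynomial σ R) else 0)
          (aeval (fun i => C (a i) + X i) D)) =
      aeval (fun i => if i ∈ S then X i else C (a i)) D := by
  have key :
      ((aeval fun i => X i - C (a i)) : MvPolynomial σ R →ₐ[R] MvPolynomial σ R).comp
          (((aeval fun i => if i ∈ S then (X i : MvPolynomial σ R) else 0) :
              MvPolynomial σ R →ₐ[R] MvPolynomial σ R).comp
            (aeval fun i => C (a i) + X i)) =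
        aeval (fun i => if i ∈ S then X i else C (a i)) :=
    MvPolynomial.algHom_ext fun i => by
      simp only [AlgHom.comp_apply, aeval_X, map_add, aeval_C, algebraMap_eq]
      split_ifs <;> simp
  exact AlgHom.congr_fun key D

/-- Killing the variables outside `S` keeps exactly the monomials supported inside `S` (and
creates no new ones). [cite: ForbesShpilkaVolk2018, Lemma 32 (proof)] -/
theorem support_subst_subset (S : Finset σ) (G : MvPolynomial σ R) :
    (aeval (fun i => if i ∈ S then (X i : MvPolynomial σ R) else 0) G).support ⊆
      G.support.filter fun m => m.support ⊆ S := by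
  intro m hm
  have hsum : aeval (fun i => if i ∈ S then (X i : MvPolynomial σ R) else 0) G =
      ∑ m ∈ G.support, aeval (fun i => if i ∈ S then (X i : MvPolynomial σ R) else 0)
        (monomial m (coeff m G)) := by
    conv_lhs => rw [G.as_sum]
    rw [map_sum]
  rw [hsum] at hm
  obtain ⟨m', hm', hmm'⟩ := Finset.mem_biUnion.mp (support_sum hm)
  by_cases h : m'.support ⊆ S
  · rw [subst_monomial_of_subset S h] at hmm'
    rw [Finset.mem_singleton.mp (support_monomial_subset hmm')]
    exact Finset.mem_filter.mpr ⟨hm', h⟩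
  · rw [subst_monomial_of_not_subset S h, support_zero] at hmm'
    exact absurd hmm' (Finset.notMem_empty _)

/-- Partial evaluation sends a term to a term: `c · x^m ↦ (c ∏_{i ∉ S} a_i^{m_i}) · x^{m|S}`.
[cite: ForbesShpilkaVolk2018, Lemma 32 (proof)] -/
theorem partialEval_monomial (S : Finset σ) (a : σ → R) (m : σ →₀ ℕ) (c : R) :
    aeval (fun i => if i ∈ S then X i else C (a i)) (monomial m c) =
      monomial (m.filter (· ∈ S)) (c * ∏ i ∈ m.support.filter (· ∉ S), a i ^ m i) := by
  rw [aeval_monomial, Finsupp.prod, algebraMap_eq,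
    ← Finset.prod_filter_mul_prod_filter_not m.support (· ∈ S)]
  have h1 : ∏ i ∈ m.support.filter (· ∈ S),
      (if i ∈ S then (X i : MvPolynomial σ R) else C (a i)) ^ m i =
        monomial (m.filter (· ∈ S)) 1 := by
    rw [← prod_X_pow_eq_monomial, Finsupp.support_filter]
    refine Finset.prod_congr rfl fun i hi => ?_
    rw [Finset.mem_filter] at hi
    rw [if_pos hi.2, Finsupp.filter_apply_pos _ _ hi.2]
  have h2 : ∏ i ∈ m.support.filter (fun i => ¬ i ∈ S),
      (if i ∈ S then (X i : MvPolynomial σ R) else C (a i)) ^ m i =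
        C (∏ i ∈ m.support.filter (· ∉ S), a i ^ m i) := by
    rw [map_prod]
    refine Finset.prod_congr rfl fun i hi => ?_
    rw [Finset.mem_filter] at hi
    rw [if_neg hi.2, map_pow]
  rw [h1, h2, mul_comm (monomial _ _) (C _), ← mul_assoc, ← C_mul, C_mul_monomial, mul_one]

/-- Partial evaluation does not increase the number of monomials: the monomials of
`D(X_i (i ∈ S), a_i (i ∉ S))` are restrictions to `S` of monomials of `D`.
[cite: ForbesShpilkaVolk2018, Lemma 32 (proof)] -/
theorem card_support_partialEval_le (S : Finset σ) (a : σ → R) (D : MvPolynomial σ R) :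
    (aeval (fun i => if i ∈ S then X i else C (a i)) D).support.card ≤ D.support.card := by
  have hsub : (aeval (fun i => if i ∈ S then X i else C (a i)) D).support ⊆
      D.support.image fun m => m.filter (· ∈ S) := by
    have hsum : aeval (fun i => if i ∈ S then X i else C (a i)) D =
        ∑ m ∈ D.support, monomial (m.filter (· ∈ S))
          (coeff m D * ∏ i ∈ m.support.filter (· ∉ S), a i ^ m i) := by
      conv_lhs => rw [D.as_sum]
      rw [map_sum]
      exact Finset.sum_congr rfl fun m _ => partialEval_monomial S a m _
    intro m' hm'
    rw [hsum] at hm'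
    obtain ⟨m, hm, hmm'⟩ := Finset.mem_biUnion.mp (support_sum hm')
    exact Finset.mem_image.mpr
      ⟨m, hm, (Finset.mem_singleton.mp (support_monomial_subset hmm')).symm⟩
  exact (Finset.card_le_card hsub).trans Finset.card_image_le

/-- The heart of FSV Lemma 32: if every monomial of `G` supported inside `S` is supported on
exactly `S`, and killing the variables outside `S` leaves `G` nonzero, then the un-shift of the
killed polynomial is `(∏_{i ∈ S} (X_i - a_i)) · H` with `H ≠ 0`.
[cite: ForbesShpilkaVolk2018, Lemma 32] -/
theorem unshift_subst_eq_prod_mul (S : Finset σ) (a : σ → R) (G : MvPolynomial σ R)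
    (hmin : ∀ m ∈ G.support, m.support ⊆ S → m.support = S)
    (hP0 : aeval (fun i => if i ∈ S then (X i : MvPolynomial σ R) else 0) G ≠ 0) :
    ∃ H : MvPolynomial σ R, H ≠ 0 ∧
      aeval (fun i => X i - C (a i))
          (aeval (fun i => if i ∈ S then (X i : MvPolynomial σ R) else 0) G) =
        (∏ i ∈ S, (X i - C (a i))) * H := by
  obtain ⟨Hq, hHq⟩ :=
    prod_X_dvd S (aeval (fun i => if i ∈ S then (X i : MvPolynomial σ R) else 0) G)
      fun m hm => by
        obtain ⟨hmG, hsub⟩ := Finset.mem_filter.mp (support_subst_subset S G hm)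
        exact (Finset.Subset.antisymm_iff.mp (hmin m hmG hsub)).2
  refine ⟨aeval (fun i => X i - C (a i)) Hq, fun h0 => hP0 ?_, ?_⟩
  · rw [hHq, ← shift_unshift a Hq, h0, map_zero, mul_zero]
  · rw [hHq, map_mul, map_prod]
    simp only [aeval_X]

/-! ### FSV Lemma 32 (a full-support shift of a sparse polynomial has a narrow monomial) -/

/-- **FSV Lemma 32 ([Forbes 2015; GKST 2016]), form `2^{|supp m|} ≤ |supp D|`:** over an integral
domain, if `D ≠ 0` and every `a i ≠ 0`, the Taylor shift `D(a + X)` has a monomial `m` with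
`2 ^ |supp m| ≤ |supp D|`. [cite: ForbesShpilkaVolk2018, Lemma 32] -/
theorem exists_narrow_monomial [IsDomain R] (a : σ → R) (ha : ∀ i, a i ≠ 0)
    {D : MvPolynomial σ R} (hD : D ≠ 0) :
    ∃ m ∈ (aeval (fun i => C (a i) + X i) D).support, 2 ^ m.support.card ≤ D.support.card := by
  -- the shift `G = D(a + X)` is nonzero
  have hG0 : aeval (fun i => C (a i) + X i) D ≠ 0 := fun h0 =>
    hD (by rw [← unshift_shift a D, h0, map_zero])
  -- a monomial `m₀` of `G` with the fewest variables, `S = supp m₀`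
  obtain ⟨m₀, hm₀, hmin⟩ := (aeval (fun i => C (a i) + X i) D).support.exists_min_image
    (fun m => m.support.card) (support_nonempty.mpr hG0)
  refine ⟨m₀, hm₀, ?_⟩
  -- killing the variables outside `S` leaves `G` nonzero (the coefficient of `m₀` survives)
  have hP0 : aeval (fun i => if i ∈ m₀.support then (X i : MvPolynomial σ R) else 0)
      (aeval (fun i => C (a i) + X i) D) ≠ 0 := by
    intro h0
    have h := coeff_subst_self m₀.support (aeval (fun i => C (a i) + X i) D)
      (subset_refl m₀.support)
    rw [h0, coeff_zero] at h
    exact (mem_support_iff.mp hm₀) h.symm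
  -- un-shift: `(∏_{i ∈ S} (X_i - a_i)) · H = D(X_S, a_{Sᶜ})`
  obtain ⟨H, hH0, hfac⟩ := unshift_subst_eq_prod_mul m₀.support a
    (aeval (fun i => C (a i) + X i) D)
    (fun m hm hsub => Finset.eq_of_subset_of_card_le hsub (hmin m hm)) hP0
  rw [unshift_subst_shift] at hfac
  calc 2 ^ m₀.support.card
      ≤ ((∏ i ∈ m₀.support, (X i - C (a i))) * H).support.card :=
        prodSparsity _ a (fun i _ => ha i) H hH0
    _ = (aeval (fun i => if i ∈ m₀.support then X i else C (a i)) D).support.card := by rw [hfac]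
    _ ≤ D.support.card := card_support_partialEval_le _ a D

/-- **FSV Lemma 32, printed form:** if `D ≠ 0` has at most `s` monomials and `a` has full support,
`D(a + X)` has a monomial of support at most `log s` (`Nat.log 2 s = ⌊log₂ s⌋`).
[cite: ForbesShpilkaVolk2018, Lemma 32] -/
theorem exists_narrow_monomial_log [IsDomain R] (a : σ → R) (ha : ∀ i, a i ≠ 0)
    {D : MvPolynomial σ R} (hD : D ≠ 0) {s : ℕ} (hs : D.support.card ≤ s) :
    ∃ m ∈ (aeval (fun i => C (a i) + X i) D).support, m.support.card ≤ Nat.log 2 s := by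
  obtain ⟨m, hm, hle⟩ := exists_narrow_monomial a ha hD
  exact ⟨m, hm, Nat.le_log_of_pow_le (by norm_num) (hle.trans hs)⟩

end Literature.Computability.AlgebraicComplexity.SparseShift
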